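/-
Copyright (c) 2026 the pub-hodgecm-mathlib formalisation cell (harness21).  Prover seat hodgecm-mathlib-R90-C131-p04 (g3) on the S4 valve (dealer K2E2-plan (g8), S4-R39 (3) ∕
S4-R44 ORDER), road (J̃♭) FILE (TJ4), part 2 of 2: THE LOCAL ε-TWISTED TUBE-JACOBIAN SOCKET FROM CHART DATA («W-LOC»), TRANSVERSAL × WINDOW FORM — ε-twins of
★ C8b-socket-core `tube_coset_identity` ∕ `tubeJacobianLocal_of_chartData` for the family `Ψ (x, b) = x · b · ε(x)⁻¹`.
Crux H413 `stmt-HodgeConjecture-24833`, lane `--supports … --as helper` (count-neutral).  THEOREMS ONLY (no `def`, no `instance`, no notation, no named-fact hypothesis, no `sorry`).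
-/
import Summits.HodgeConjecture.HodgeConjecture.Theorems.R90S4TwistedTubeWindows          -- (TJ4) part 1 (this seat): `continuousOn_twisted_slot`, `isCompact_image_transversal`, `twistedTube_image_eq`, `exists_param_twisted`, `isOpen_image_twisted_slot`
import Summits.HodgeConjecture.HodgeConjecture.Theorems.F0P3cStCharTSJacCartanSocketCore  -- ★ C8b-socket-core (brings ★ C8b-window `chart_window_eq` ∕ `measure_window_eq` ∕ `quotientMeasure_window_ne`, ★ C8b-tube `cosetWindow_nested_or_disjoint`, ★ (Q4), ★ `LocallyCompactPolish`)
import HarnessLib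

/-!
# R90-TF · S4 (Ch. 13.1–2) · road (J̃♭) «TWISTED TUBE JACOBIAN», FILE (TJ4) part 2: THE LOCAL ε-TWISTED TUBE-JACOBIAN SOCKET «W-LOC» (transversal × window form)

Cell `hodgecm-mathlib`, crux H413 (`stmt-HodgeConjecture-24833`, lane `--supports … --as helper`), route of record `HCCMUnconditional` (no route verbs;
count-neutral).  Programme R90-TF, section S4 = [Rogawski1990] Ch. 13.1–13.2 (twisted Weyl integration formula, §12.5 p. 186: the factor `D_G(N δ)`); seat
R90-C131-p04 (g3); ORDER = S4 dealer K2E2-plan (g8) S4-R39 (3) ∕ S4-R44 + K2E3-p03 (g10) (TJ5) census 02:33:29Z (ii) «W-LOC».  THEOREMS ONLY — Mathlib + ★ (TJ2) +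
(TJ4) part 1 + ★ C8b-window∕tube∕socket-core + ★ (Q1) (inside ★ C8b-window) + ★ (Q4); ★-only imports.

SETTING = (TJ4) part 1's (★ (C4) chart frame; `pM + pT = id`; sub-box `Λ′`; a CLOSED subgroup `T ≤ G` linked to `ker pM` through the chart; base point `t₀ ∈ T`
with `ρ t₀^{±1}` integral; ★ (TJ2)'s slot data `(E, hE, hEc, hL, hΘ)` and the abstract twist `(ε, hε, hεc)`; the family `Ψ (x, b) = x b ε(x)⁻¹` on `G × ↥T`; the
transversal `M₀ = c '' (pM '' Λ′ k)`), plus the measures of ★ C8b-socket-core: `μ` additive Haar on `V` with the chart identity `κ · ν(c B) = μ B` on `Λ 0`, `ν` Haar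
and right invariant on `G`, `tm` a left-invariant inversion-invariant s-finite measure on `↥T` finite on compacts and positive on opens (⊇ the ORDER's `[IsHaarMeasure]`),
and a weight `D : ↥T → ℝ≥0` constant `= addEquivAddHaarChar L` on the base window (at S4: `D = cartanWeight ∘ N`, ★ (TJ3) p864488).

THE RESULTS (all PROVED; ε-twins of the named ★ decls, proofs token-for-token).
* §1 **`twistedTube_coset_identity`** — `ν(Ψ(M₀ × C)) = m₀ · ∫⁻_C D dtm` on every coset window `C = {b ∈ T | b ∈ t₀ c(Y + Λ_j)}` (`Y ∈ Λ_k ∩ ker pM`, `j ≥ k`),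
  with the TRANSVERSAL MASS `m₀ := quotientMeasure T tm _ ν (π(c(Λ′_k)))` (★ C8b-window `measure_window_eq`, ★ Q1 by `T` itself — no finer quotient) — ★ (TJ2)
  tube measure + ★ C8b-window masses; `κ` cancels.
* §2 **`twistedTubeJacobianLocal_window`** — THE SOCKET with the explicit window `U = {b ∈ T | b ∈ t₀·c(Λ_k)}`: `M₀` Borel, `0 < m₀ < ∞`, `Ψ` injective on
  `M₀ × U`, and **`ν(Ψ(M₀ × V′)) = m₀ · ∫⁻_{V′} D dtm` for every Borel `V′ ⊆ U`** (★ (Q4) over the nested-or-disjoint coset windows; measurable embedding from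
  chart injectivity + ★ C1 injectivity of `Θ` on `Λ′ k`); **`twistedTubeJacobianLocal_of_chartData`** (`∃ U` form) and **`twistedTubeJacobianLocal_of_chartData'`**
  (the ORDER's literal shape `∃ U, … ∃ M₀, M₀ = c '' (pM '' Λ′ k) ∧ … ∃ m₀, m₀ ≠ 0 ∧ m₀ ≠ ⊤ ∧ ∀ V′ …`).

Purpose: the [A]-input («W-LOC at a base point `b₀`») of K2E3-p03 (g10)'s (TJ5) `R90S4TwistedTubeJacobian` (`twistedTubeJacobian_of_local`); [B] instantiates
it at `GL₃(L_w) ⊃ T̃ = Cent(N b₀)` with `E = τ`, `ε = epsLoc` (elliptic members), [C] sweeps by `T′ = ι(T)`.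
HONEST LABEL: HC_CM is proved only modulo the 7 printed citations (2 remaining named inputs: hLiu418 = `stmt-HodgeConjecture-24832`, h413 =
`stmt-HodgeConjecture-24833`) until rung 0 closes; this file closes no socket (REL ≠ ★ ≠ BUILT; count-neutral).

## References
* [Rogawski1990] J. D. Rogawski, *Automorphic Representations of Unitary Groups in Three Variables*, Ann. of Math. Stud. 123 (1990), §12.5 p. 186. Context locator.
* [HarishChandra1970] Harish-Chandra (notes by G. van Dijk), *Harmonic Analysis on Reductive p-adic Groups*, LNM 162 (1970), Lemma 22. Context locator.
* [DeitmarEchterhoff2014] A. Deitmar, S. Echterhoff, *Principles of Harmonic Analysis*, 2nd ed., Thm. 1.5.3 (quotient integral formula). Context locator.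
* [Serre1992LALG] J.-P. Serre, *Lie Algebras and Lie Groups*, LNM 1500 (1992), Part II Ch. IV §8–§9. Context locator.
-/

set_option autoImplicit false
-- the mandated namespace repeats the single-problem summit's segment (`HodgeConjecture.HodgeConjecture`)
set_option linter.dupNamespace false

open Set Filter MeasureTheory MeasureTheory.Measure TopologicalSpace Topology Matrix ValuativeRel
open Literature.NumberTheory.Automorphic Literature.NumberTheory.Weil1982.UnitaryFinTopForm Literature.MeasureTheory.Group Literature.MeasureTheory.Measure
open Summit.HodgeConjecture.HodgeConjecture.Cruxes.H413.F0P3cStCharTSCayleyChartHaar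
open Summit.HodgeConjecture.HodgeConjecture.Cruxes.H413.F0P3cStCharTSFilteredNewton
open Summit.HodgeConjecture.HodgeConjecture.Cruxes.H413.F0P3cStCharTSTwistedTubeCore
open Summit.HodgeConjecture.HodgeConjecture.Cruxes.H413.F0P3cStCharTSJacCartanProduct
open Summit.HodgeConjecture.HodgeConjecture.Cruxes.H413.F0P3cStCharTSJacCartanWindow
open Summit.HodgeConjecture.HodgeConjecture.Cruxes.H413.F0P3cStCharTSJacCartanTube
open scoped Pointwise Topology ENNReal NNReal MatrixGroups

namespace Summit.HodgeConjecture.HodgeConjecture.R90.S4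

variable {K : Type*} [Field K] [ValuativeRel K] [TopologicalSpace K] [IsNonarchimedeanLocalField K]
  {m : Type*} [Fintype m] [DecidableEq m]
  {V : Type*} [AddCommGroup V] [TopologicalSpace V] [IsTopologicalAddGroup V] [T2Space V]
  {G : Type*} [Group G] [TopologicalSpace G] [IsTopologicalGroup G]
  (ι : V →+ Matrix m m K) (Λ : ℕ → AddSubgroup V) {α : ValueGroupWithZero K} (ρ : G →* GL m K) (c : V → G) (σV : V → V → V)
  (pM pT : V →+ V) {Λ' : ℕ → AddSubgroup V} (L : V ≃ₜ+ V) (Θ Ξ : V → V) (E : Matrix m m K →+ Matrix m m K) (ε : G → G)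
  (T : Subgroup G) {t₀ : G} {k : ℕ}

section Measure

variable [SecondCountableTopology V] [LocallyCompactSpace V] [MeasurableSpace V] [BorelSpace V] (μ : Measure V) [μ.IsAddHaarMeasure]
  [T2Space G] [LocallyCompactSpace G] [SecondCountableTopology G] [MeasurableSpace G] [BorelSpace G]
  [MeasurableSpace (G ⧸ T)] [BorelSpace (G ⧸ T)]
  (ν : Measure G) [ν.IsHaarMeasure] [ν.IsMulRightInvariant]
  (tm : Measure ↥T) [tm.IsMulLeftInvariant] [IsFiniteMeasureOnCompacts tm] [tm.IsOpenPosMeasure] [tm.IsInvInvariant] [SFinite tm]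

/-! ## §1 The identity on a coset window -/

/-- **THE ε-TWISTED TUBE IDENTITY ON A COSET WINDOW**: `ν(Ψ(M₀ × C)) = m₀ · ∫⁻_C D dtm` for the transversal `M₀ = c '' (pM '' Λ′ k)`, the coset window
`C = {b ∈ T | b ∈ t₀ c(Y + Λ_j)}` (`Y ∈ Λ_k`, `pM Y = 0`, `j ≥ k`), the transversal mass `m₀ = quotientMeasure T tm _ ν (π c(Λ′_k))`, and a weight `D` constant
`= addEquivAddHaarChar L` on the base window — ★ (TJ2) `tube_measure_eq_twisted_slot` + ★ C8b-window `chart_window_eq` ∕ `measure_window_eq` (the chart constant `κ`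
cancels); ε-twin of ★ C8b-socket-core `tube_coset_identity`. [cite: Rogawski1990, §12.5 p. 186] [cite: HarishChandra1970, Lemma 22] [cite: DeitmarEchterhoff2014, Thm. 1.5.3] -/
theorem twistedTube_coset_identity (hTcl : IsClosed (T : Set G)) (hι : IsClosedEmbedding ι) (hΛ : ∀ j X, X ∈ Λ j ↔ ValBound (α ^ (j + 1)) (ι X)) (hα : α ≠ 0)
    (hα1 : α < 1) (h2 : (2 : K) ≠ 0) (hρinj : Function.Injective ρ) (hc : ∀ X ∈ Λ 0, ((ρ (c X) : GL m K) : Matrix m m K) = cayley (ι X))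
    (hcc : ContinuousOn c (Λ 0 : Set V)) (hK0 : IsOpen (c '' (Λ 0 : Set V)))
    (hσ : ∀ W ∈ Λ 0, ∀ X ∈ Λ 0, ι (σV W X) = (1 - ι W)⁻¹ * (ι W + ι X) * (1 + ι W * ι X)⁻¹ * (1 - ι W))
    (hσc : ∀ W ∈ Λ 0, ContinuousOn (σV W) (Λ 0 : Set V))
    (hΛ' : ∀ j Z, Z ∈ Λ' j ↔ (pM Z ∈ Λ j ∧ pT Z ∈ Λ j)) (hsum : ∀ Z, pM Z + pT Z = Z) (hidem : ∀ Z, pM (pM Z) = pM Z)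
    (hpMc : Continuous pM) (hpTc : Continuous pT) (hshift : ∀ j, ∀ Z ∈ Λ (j + k), pM Z ∈ Λ j ∧ pT Z ∈ Λ j)
    (hΞ : ∀ Z ∈ Λ' k, ι (Ξ Z) = (1 - ι (pM Z))⁻¹ * (ι (pM Z) + ι (pT Z)) * (1 + ι (pM Z) * ι (pT Z))⁻¹ * (1 - ι (pM Z)))
    (hcT : ∀ Y ∈ Λ 0, pM Y = 0 → c Y ∈ T) (hTc : ∀ W ∈ Λ 0, c W ∈ T → pM W = 0) (ht₀ : t₀ ∈ T)
    (hT1 : ValBound 1 ((ρ t₀ : GL m K) : Matrix m m K)) (hTinv1 : ValBound 1 (((ρ t₀)⁻¹ : GL m K) : Matrix m m K))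
    (hE : ∀ (γ : ValueGroupWithZero K) (W : Matrix m m K), ValBound γ W → ValBound γ (E W)) (hEc : Continuous E)
    (hL : ∀ Z, ι (L Z) = (((ρ t₀)⁻¹ : GL m K) : Matrix m m K) * ι (pM Z) * ((ρ t₀ : GL m K) : Matrix m m K) + E (ι (pM Z)) + ι (pT Z))
    (hε : ∀ X ∈ Λ 0, (((ρ (ε (c X)))⁻¹ : GL m K) : Matrix m m K) = cayley (E (ι X)))
    (hΘ : ∀ Z ∈ Λ' k, ι (Θ Z) =
      (fun W X : Matrix m m K => (1 - W)⁻¹ * (W + X) * (1 + W * X)⁻¹ * (1 - W)) ((((ρ t₀)⁻¹ : GL m K) : Matrix m m K) * ι (pM Z) * ((ρ t₀ : GL m K) : Matrix m m K))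
        ((fun W X : Matrix m m K => (1 - W)⁻¹ * (W + X) * (1 + W * X)⁻¹ * (1 - W)) (ι (pT Z)) (E (ι (pM Z)))))
    (hshiftL : ∀ j, ∀ Z ∈ Λ (j + k), pM (L.symm Z) ∈ Λ j ∧ pT (L.symm Z) ∈ Λ j)
    {κ : ℝ≥0∞} (hκ0 : κ ≠ 0) (hκt : κ ≠ ∞) (hchart : ∀ B ⊆ (Λ 0 : Set V), MeasurableSet (c '' B) → κ * ν (c '' B) = μ B)
    (Ψ : G × ↥T → G) (hΨ : ∀ (x : G) (b : ↥T), Ψ (x, b) = x * b * (ε x)⁻¹)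
    (D : ↥T → ℝ≥0) (hD : ∀ b : ↥T, (b : G) ∈ t₀ • c '' (Λ k : Set V) → D b = D ⟨t₀, ht₀⟩) (hDχ : ((D ⟨t₀, ht₀⟩ : ℝ≥0) : ℝ≥0∞) = addEquivAddHaarChar L)
    {j : ℕ} (hj : k ≤ j) {Y : V} (hY : Y ∈ Λ k) (hY0 : pM Y = 0) :
    ν (Ψ '' ((c '' (pM '' (Λ' k : Set V))) ×ˢ {b : ↥T | (b : G) ∈ t₀ • c '' (Y +ᵥ (Λ j : Set V))})) =
      quotientMeasure T tm hTcl ν ((QuotientGroup.mk : G → G ⧸ T) '' (c '' (Λ' k : Set V))) *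
        ∫⁻ b in {b : ↥T | (b : G) ∈ t₀ • c '' (Y +ᵥ (Λ j : Set V))}, (D b : ℝ≥0∞) ∂tm := by
  have hanti := level_antitone ι Λ hΛ hα1.le
  have hk0 : Λ k ≤ Λ 0 := hanti (Nat.zero_le k)
  have hjk : Λ j ≤ Λ k := hanti hj
  have hP := proj_ids pM pT hsum hidem
  have hcinj := injOn_chart ι Λ ρ c h2 hι.injective hΛ hα1 hc
  have hcomp0 : IsCompact (Λ 0 : Set V) := isCompact_level ι Λ hι hΛ 0
  have hYcos : Y +ᵥ (Λ j : Set V) ⊆ (Λ k : Set V) := by rintro _ ⟨y, hy, rfl⟩; exact add_mem hY (hjk hy)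
  -- (1) the tube is `t₀ · c(Θ A)`
  rw [twistedTube_image_eq ι Λ ρ c pM pT Θ E ε T hΛ hα1 hρinj hc hΛ' hsum hidem hcT hTc ht₀ hT1 hTinv1 hE hε hΘ Ψ hΨ hj hY]
  set A : Set V := (Λ' k : Set V) ∩ pT ⁻¹' (Y +ᵥ (Λ j : Set V)) with hAdef
  set A0 : Set V := (Λ' k : Set V) ∩ pT ⁻¹' (Λ j : Set V) with hA0def
  set C : Set ↥T := {b : ↥T | (b : G) ∈ t₀ • c '' (Y +ᵥ (Λ j : Set V))} with hCdef
  set T₀ : Set ↥T := {h : ↥T | (h : G) ∈ c '' (Λ j : Set V)} with hT₀def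
  -- (2) ★ (TJ2): `κ · ν(t₀ c(Θ A)) = χ · μ A`
  have hΘA : IsOpen (Θ '' A) :=
    isOpen_image_twisted_slot ι Λ pM pT L Θ E hι hΛ hα hα1 hΛ' hsum hpMc hpTc hshift hT1 hTinv1 hE hEc hL hΘ hshiftL hj Y
  have hΘA0 : Θ '' A ⊆ (Λ 0 : Set V) := by
    rintro _ ⟨Z, hZ, rfl⟩; exact hk0 (twisted_mem_level_slot ι Λ pM pT Θ E hΛ hα1 hΛ' hT1 hTinv1 hE hΘ Z hZ.1)
  have hC8 := tube_measure_eq_twisted_slot ι Λ c pM pT L Θ E μ ν hι hΛ hα hα1 hΛ' hsum hshift hT1 hTinv1 hE hL hΘ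
    (continuousOn_twisted_slot ι Λ pM pT Θ E hι hΛ hα1 hΛ' hpMc hpTc hT1 hTinv1 hE hEc hΘ) hshiftL hchart t₀ (inter_subset_left : A ⊆ (Λ' k : Set V))
    hΘA.measurableSet (isOpen_image_of_subset c hcc hcinj hcomp0 hK0 hΘA hΘA0).measurableSet
  -- (3) `μ A = μ A0` (translation by `Y ∈ 𝔱 ∩ Λ_k`)
  have hYk' : Y ∈ Λ' k := (hΛ' k Y).2 ⟨by rw [hY0]; exact zero_mem _, by rw [(hP Y).2.2.2.2 hY0]; exact hY⟩
  have hAeq : A = Y +ᵥ A0 := by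
    ext Z
    rw [Set.mem_vadd_set_iff_neg_vadd_mem]
    simp only [hAdef, hA0def, mem_inter_iff, mem_preimage, SetLike.mem_coe, vadd_eq_add]
    rw [Set.mem_vadd_set_iff_neg_vadd_mem, vadd_eq_add, map_add, map_neg, (hP Y).2.2.2.2 hY0]
    constructor
    · rintro ⟨h1, h2⟩; exact ⟨add_mem (neg_mem hYk') h1, h2⟩
    · rintro ⟨h1, h2⟩; exact ⟨by simpa using add_mem hYk' h1, h2⟩
  have hμA : μ A = μ A0 := by rw [hAeq, measure_vadd]
  -- (4) ★ C8b-window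
  have hW1 := chart_window_eq ι Λ ρ c pM pT Ξ ν μ hι hΛ hα hα1 h2 hc hcc hK0 hΛ' hsum hpMc hpTc hshift hΞ hchart hj
  have hW2 := measure_window_eq ι Λ ρ c σV pM pT Ξ T ν tm hTcl hι hΛ hα hα1 h2 hρinj hc hcc hK0 hσ hσc hΛ' hsum hidem hpMc hpTc hshift hΞ hcT hTc hj
  -- (5) `tm C = tm T₀` (left translation by `t₀ c Y ∈ T`)
  have hgT : t₀ * c Y ∈ T := T.mul_mem ht₀ (hcT Y (hk0 hY) hY0)
  have hCeq : C = (fun b : ↥T => (⟨t₀ * c Y, hgT⟩ : ↥T)⁻¹ * b) ⁻¹' T₀ := by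
    ext b
    simp only [hCdef, hT₀def, mem_setOf_eq, mem_preimage]
    rw [image_vadd_eq_smul_image ι Λ ρ c σV hι hΛ hα hα1 h2 hρinj hc hσ hσc hj hY, smul_smul, Set.mem_smul_set_iff_inv_smul_mem, smul_eq_mul]
    rfl
  have htmC : tm C = tm T₀ := by rw [hCeq, measure_preimage_mul]
  -- (6) the weight is constant on `C ⊆ U`
  have hCU : ∀ b ∈ C, (b : G) ∈ t₀ • c '' (Λ k : Set V) := fun b hb => smul_set_mono (image_mono hYcos) hb
  have hCo : IsOpen C := ((isOpen_image_of_subset c hcc hcinj hcomp0 hK0 ((isOpen_level ι Λ hι.continuous hΛ hα j).vadd Y)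
    (hYcos.trans hk0)).smul t₀).preimage continuous_subtype_val
  have hint : ∫⁻ b in C, (D b : ℝ≥0∞) ∂tm = (D ⟨t₀, ht₀⟩ : ℝ≥0∞) * tm C := by
    rw [setLIntegral_congr_fun hCo.measurableSet (fun b hb => by rw [hD b (hCU b hb)]), setLIntegral_const]
  -- (7) bookkeeping: `κ x = χ μA0 = χ κ ν K′` ⇒ `x = χ ν K′ = χ μ₀(A₀) tm T₀`
  rw [hint, htmC, hDχ]
  rw [hμA, ← hW1] at hC8
  have hx : ν (t₀ • c '' (Θ '' A)) = addEquivAddHaarChar L * ν (c '' (Ξ '' A0)) := by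
    rw [← ENNReal.mul_right_inj hκ0 hκt, hC8]; ring
  rw [hx, hW2]; ring

/-! ## §2 The socket «W-LOC» -/

/-- **THE LOCAL ε-TWISTED TUBE-JACOBIAN SOCKET FROM CHART DATA, explicit window** («W-LOC»; transversal × window form).  In ★ (C4)'s frame with complementary
continuous additive projections `pM + pT = id` (`pM` idempotent), a closed subgroup `T` linked to `ker pM` through the chart, `t₀ ∈ T` with `ρ t₀^{±1}` integral,
★ (TJ2)'s slot data `(E, L, Θ)` and twist `ε` (`ρ(ε(c X))⁻¹ = cayley (E (ι X))`), the family `Ψ (x, b) = x b ε(x)⁻¹`, and a weight `D` constant `= addEquivAddHaarChar L`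
on the base window: with **`U = {b ∈ T | b ∈ t₀ c(Λ_k)}`**, the transversal **`M₀ = c '' (pM '' Λ′ k)`** (Borel) and the transversal mass
**`m₀ = quotientMeasure T tm _ ν (π c(Λ′_k))`** (positive, finite): `U` is an open neighbourhood of `t₀`, `Ψ` is injective on `M₀ × U`, and
**`ν(Ψ(M₀ × V′)) = m₀ · ∫⁻_{V′} D dtm` for every Borel `V′ ⊆ U`** — ★ (Q4) over the nested-or-disjoint coset windows (★ C8b-tube `cosetWindow_nested_or_disjoint`),
the identity on each window being §1, the measurable embedding coming from chart injectivity and ★ C1 injectivity of `Θ` on `Λ′ k`; ε-twin of ★ C8b-socket-core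
`tubeJacobianLocal_of_chartData`. [cite: Rogawski1990, §12.5 p. 186] [cite: HarishChandra1970, Lemma 22] [cite: DeitmarEchterhoff2014, Thm. 1.5.3] -/
theorem twistedTubeJacobianLocal_window (hTcl : IsClosed (T : Set G)) (hι : IsClosedEmbedding ι) (hΛ : ∀ j X, X ∈ Λ j ↔ ValBound (α ^ (j + 1)) (ι X))
    (hα : α ≠ 0) (hα1 : α < 1) (h2 : (2 : K) ≠ 0) (hρinj : Function.Injective ρ) (hc : ∀ X ∈ Λ 0, ((ρ (c X) : GL m K) : Matrix m m K) = cayley (ι X))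
    (hcc : ContinuousOn c (Λ 0 : Set V)) (hK0 : IsOpen (c '' (Λ 0 : Set V)))
    (hσ : ∀ W ∈ Λ 0, ∀ X ∈ Λ 0, ι (σV W X) = (1 - ι W)⁻¹ * (ι W + ι X) * (1 + ι W * ι X)⁻¹ * (1 - ι W))
    (hσc : ∀ W ∈ Λ 0, ContinuousOn (σV W) (Λ 0 : Set V))
    (hΛ' : ∀ j Z, Z ∈ Λ' j ↔ (pM Z ∈ Λ j ∧ pT Z ∈ Λ j)) (hsum : ∀ Z, pM Z + pT Z = Z) (hidem : ∀ Z, pM (pM Z) = pM Z)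
    (hpMc : Continuous pM) (hpTc : Continuous pT) (hshift : ∀ j, ∀ Z ∈ Λ (j + k), pM Z ∈ Λ j ∧ pT Z ∈ Λ j)
    (hΞ : ∀ Z ∈ Λ' k, ι (Ξ Z) = (1 - ι (pM Z))⁻¹ * (ι (pM Z) + ι (pT Z)) * (1 + ι (pM Z) * ι (pT Z))⁻¹ * (1 - ι (pM Z)))
    (hcT : ∀ Y ∈ Λ 0, pM Y = 0 → c Y ∈ T) (hTc : ∀ W ∈ Λ 0, c W ∈ T → pM W = 0) (ht₀ : t₀ ∈ T)
    (hT1 : ValBound 1 ((ρ t₀ : GL m K) : Matrix m m K)) (hTinv1 : ValBound 1 (((ρ t₀)⁻¹ : GL m K) : Matrix m m K))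
    (hE : ∀ (γ : ValueGroupWithZero K) (W : Matrix m m K), ValBound γ W → ValBound γ (E W)) (hEc : Continuous E)
    (hL : ∀ Z, ι (L Z) = (((ρ t₀)⁻¹ : GL m K) : Matrix m m K) * ι (pM Z) * ((ρ t₀ : GL m K) : Matrix m m K) + E (ι (pM Z)) + ι (pT Z))
    (hε : ∀ X ∈ Λ 0, (((ρ (ε (c X)))⁻¹ : GL m K) : Matrix m m K) = cayley (E (ι X))) (hεc : Continuous ε)
    (hΘ : ∀ Z ∈ Λ' k, ι (Θ Z) =
      (fun W X : Matrix m m K => (1 - W)⁻¹ * (W + X) * (1 + W * X)⁻¹ * (1 - W)) ((((ρ t₀)⁻¹ : GL m K) : Matrix m m K) * ι (pM Z) * ((ρ t₀ : GL m K) : Matrix m m K))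
        ((fun W X : Matrix m m K => (1 - W)⁻¹ * (W + X) * (1 + W * X)⁻¹ * (1 - W)) (ι (pT Z)) (E (ι (pM Z)))))
    (hshiftL : ∀ j, ∀ Z ∈ Λ (j + k), pM (L.symm Z) ∈ Λ j ∧ pT (L.symm Z) ∈ Λ j)
    {κ : ℝ≥0∞} (hκ0 : κ ≠ 0) (hκt : κ ≠ ∞) (hchart : ∀ B ⊆ (Λ 0 : Set V), MeasurableSet (c '' B) → κ * ν (c '' B) = μ B)
    (Ψ : G × ↥T → G) (hΨ : ∀ (x : G) (b : ↥T), Ψ (x, b) = x * b * (ε x)⁻¹)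
    (D : ↥T → ℝ≥0) (hD : ∀ b : ↥T, (b : G) ∈ t₀ • c '' (Λ k : Set V) → D b = D ⟨t₀, ht₀⟩) (hDχ : ((D ⟨t₀, ht₀⟩ : ℝ≥0) : ℝ≥0∞) = addEquivAddHaarChar L) :
    IsOpen {b : ↥T | (b : G) ∈ t₀ • c '' (Λ k : Set V)} ∧ (⟨t₀, ht₀⟩ : ↥T) ∈ {b : ↥T | (b : G) ∈ t₀ • c '' (Λ k : Set V)} ∧
      MeasurableSet (c '' (pM '' (Λ' k : Set V))) ∧
      quotientMeasure T tm hTcl ν ((QuotientGroup.mk : G → G ⧸ T) '' (c '' (Λ' k : Set V))) ≠ 0 ∧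
      quotientMeasure T tm hTcl ν ((QuotientGroup.mk : G → G ⧸ T) '' (c '' (Λ' k : Set V))) ≠ ∞ ∧
      InjOn Ψ ((c '' (pM '' (Λ' k : Set V))) ×ˢ {b : ↥T | (b : G) ∈ t₀ • c '' (Λ k : Set V)}) ∧
      ∀ V' : Set ↥T, MeasurableSet V' → V' ⊆ {b : ↥T | (b : G) ∈ t₀ • c '' (Λ k : Set V)} →
        ν (Ψ '' ((c '' (pM '' (Λ' k : Set V))) ×ˢ V')) =
          quotientMeasure T tm hTcl ν ((QuotientGroup.mk : G → G ⧸ T) '' (c '' (Λ' k : Set V))) * ∫⁻ b in V', (D b : ℝ≥0∞) ∂tm := by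
  haveI : IsClosed (T : Set G) := hTcl
  have hanti := level_antitone ι Λ hΛ hα1.le
  have hanti' : Antitone Λ' := subBox_antitone hΛ' hanti
  have hk0 : Λ k ≤ Λ 0 := hanti (Nat.zero_le k)
  have hcinj := injOn_chart ι Λ ρ c h2 hι.injective hΛ hα1 hc
  have hcomp0 : IsCompact (Λ 0 : Set V) := isCompact_level ι Λ hι hΛ 0
  have hopenΛ := isOpen_level ι Λ hι.continuous hΛ hα
  have h0 : c 0 = 1 := chart_zero ι Λ ρ c hρinj hc
  -- the window `U` and the transversal `M₀`
  set U : Set ↥T := {b : ↥T | (b : G) ∈ t₀ • c '' (Λ k : Set V)} with hUdef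
  set M₀ : Set G := c '' (pM '' (Λ' k : Set V)) with hM₀def
  have hopen_img : ∀ {S : Set V}, IsOpen S → S ⊆ (Λ 0 : Set V) → IsOpen {b : ↥T | (b : G) ∈ t₀ • c '' S} := fun hS hS0 =>
    ((isOpen_image_of_subset c hcc hcinj hcomp0 hK0 hS hS0).smul t₀).preimage continuous_subtype_val
  have hUo : IsOpen U := hopen_img (hopenΛ k) hk0
  have ht₀U : (⟨t₀, ht₀⟩ : ↥T) ∈ U := ⟨1, ⟨0, zero_mem _, h0⟩, by simp⟩
  have hM₀m : MeasurableSet M₀ := (isCompact_image_transversal ι Λ c pM pT hι hΛ hα hα1 hcc hΛ' hsum hpMc hshift).isClosed.measurableSet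
  have hne := quotientMeasure_window_ne ι Λ ρ c σV pM pT Ξ T ν tm hTcl hι hΛ hα hα1 h2 hρinj hc hcc hK0 hσ hσc hΛ' hsum hidem hpMc hpTc hshift hΞ hcT hTc
  -- injectivity of `Ψ` on `M₀ × U`: parametrisation + ★ C1 injectivity of `Θ` on `Λ′ k` + chart injectivity
  have hinjΘ : InjOn Θ (Λ' k : Set V) := injOn_of_linearNewton Λ' Θ L hanti' (subBox_basis hΛ' hsum (exists_level_subset_of_mem_nhds ι Λ hι hΛ hα1))
    (twisted_newton_slot ι Λ pM pT L Θ E hΛ hα1 hΛ' hT1 hTinv1 hE hL hΘ hshiftL)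
  have hinj : InjOn Ψ (M₀ ×ˢ U) := by
    rintro ⟨x, b⟩ ⟨hx, hb⟩ ⟨x', b'⟩ ⟨hx', hb'⟩ hEq
    rw [hUdef, mem_setOf_eq, ← zero_vadd V (Λ k : Set V)] at hb hb'
    obtain ⟨Z, hZ, hxZ, hbZ, hΨZ⟩ := exists_param_twisted ι Λ ρ c pM pT Θ E ε T hΛ hα1 hρinj hc hΛ' hsum hidem hTc ht₀ hT1 hTinv1 hE hε hΘ Ψ hΨ
      le_rfl (zero_mem _) hx hb
    obtain ⟨Z', hZ', hxZ', hbZ', hΨZ'⟩ := exists_param_twisted ι Λ ρ c pM pT Θ E ε T hΛ hα1 hρinj hc hΛ' hsum hidem hTc ht₀ hT1 hTinv1 hE hε hΘ Ψ hΨ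
      le_rfl (zero_mem _) hx' hb'
    have hE' : Ψ (x, b) = Ψ (x', b') := hEq
    rw [hΨZ, hΨZ'] at hE'
    have hZZ : Z = Z' := hinjΘ hZ.1 hZ'.1 (hcinj (hk0 (twisted_mem_level_slot ι Λ pM pT Θ E hΛ hα1 hΛ' hT1 hTinv1 hE hΘ Z hZ.1))
      (hk0 (twisted_mem_level_slot ι Λ pM pT Θ E hΛ hα1 hΛ' hT1 hTinv1 hE hΘ Z' hZ'.1)) (mul_left_cancel hE'))
    subst hZZ
    exact Prod.ext (hxZ.trans hxZ'.symm) (Subtype.ext (hbZ.trans hbZ'.symm))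
  refine ⟨hUo, ht₀U, hM₀m, hne.1, hne.2, hinj, fun V' hV' hV'U => ?_⟩
  -- the coset windows
  set 𝒞 : Set (Set ↥T) := {C | ∃ j, k ≤ j ∧ ∃ Y ∈ (Λ k : Set V), pM Y = 0 ∧ C = {b : ↥T | (b : G) ∈ t₀ • c '' (Y +ᵥ (Λ j : Set V))}} with h𝒞def
  have hYcos : ∀ {j : ℕ} {Y : V}, k ≤ j → Y ∈ Λ k → Y +ᵥ (Λ j : Set V) ⊆ (Λ k : Set V) := by
    rintro j Y hj hY _ ⟨y, hy, rfl⟩; exact add_mem hY (hanti hj hy)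
  have hUeq : U = {b : ↥T | (b : G) ∈ t₀ • c '' ((0 : V) +ᵥ (Λ k : Set V))} := by rw [zero_vadd]
  have hU𝒞 : U ∈ 𝒞 := ⟨k, le_rfl, 0, zero_mem _, map_zero _, hUeq⟩
  have h𝒞o : ∀ C ∈ 𝒞, IsOpen C := by
    rintro C ⟨j, hj, Y, hY, -, rfl⟩; exact hopen_img ((hopenΛ j).vadd Y) ((hYcos hj hY).trans hk0)
  have h𝒞U : ∀ C ∈ 𝒞, C ⊆ U := by
    rintro C ⟨j, hj, Y, hY, -, rfl⟩ b hb; exact smul_set_mono (image_mono (hYcos hj hY)) hb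
  have hπ : IsPiSystem 𝒞 := isPiSystem_of_subset_or_disjoint 𝒞 (by
    rintro C ⟨j, hj, Y, hY, -, rfl⟩ C' ⟨j', hj', Y', hY', -, rfl⟩
    exact cosetWindow_nested_or_disjoint ι Λ ρ c T hι.injective hΛ hα1 h2 hc hj hj' hY hY')
  have hbasis : ∀ O : Set ↥T, IsOpen O → O ⊆ U → ∀ y ∈ O, ∃ C ∈ 𝒞, y ∈ C ∧ C ⊆ O := by
    intro O hO hOU y hy
    obtain ⟨_, ⟨Y, hY, rfl⟩, hyY⟩ := hOU hy
    have hyY' : t₀ * c Y = (y : G) := hyY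
    have hcYT : c Y ∈ T := by
      have : c Y = t₀⁻¹ * (y : G) := by rw [← hyY', inv_mul_cancel_left]
      rw [this]; exact T.mul_mem (T.inv_mem ht₀) y.2
    have hY0 : pM Y = 0 := hTc Y (hk0 hY) hcYT
    obtain ⟨O', hO', rfl⟩ := isOpen_induced_iff.1 hO
    have hO'y : {g : G | (y : G) * g ∈ O'} ∈ 𝓝 (1 : G) :=
      (hO'.preimage (continuous_const.mul continuous_id)).mem_nhds (by simpa using hy)
    obtain ⟨j', hj'⟩ := exists_image_level_subset Λ c hopenΛ (exists_level_subset_of_mem_nhds ι Λ hι hΛ hα1) hcc h0 _ hO'y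
    refine ⟨{b : ↥T | (b : G) ∈ t₀ • c '' (Y +ᵥ (Λ (max j' k) : Set V))}, ⟨max j' k, le_max_right _ _, Y, hY, hY0, rfl⟩, ?_, ?_⟩
    · exact ⟨c Y, ⟨Y, ⟨0, zero_mem _, by simp⟩, rfl⟩, hyY'⟩
    · intro b hb
      rw [mem_setOf_eq, image_vadd_eq_smul_image ι Λ ρ c σV hι hΛ hα hα1 h2 hρinj hc hσ hσc (le_max_right j' k) hY, smul_smul, hyY'] at hb
      obtain ⟨_, ⟨z, hz, rfl⟩, hbz⟩ := hb
      show (b : G) ∈ O'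
      rw [← hbz]
      exact hj' ⟨z, hanti (le_max_left j' k) hz, rfl⟩
  have heq : ∀ C ∈ 𝒞, ν (Ψ '' (M₀ ×ˢ C)) =
      quotientMeasure T tm hTcl ν ((QuotientGroup.mk : G → G ⧸ T) '' (c '' (Λ' k : Set V))) * ∫⁻ b in C, (D b : ℝ≥0∞) ∂tm := by
    rintro C ⟨j, hj, Y, hY, hY0, rfl⟩
    exact twistedTube_coset_identity ι Λ ρ c σV pM pT L Θ Ξ E ε T μ ν tm hTcl hι hΛ hα hα1 h2 hρinj hc hcc hK0 hσ hσc hΛ' hsum hidem hpMc hpTc hshift hΞ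
      hcT hTc ht₀ hT1 hTinv1 hE hEc hL hε hΘ hshiftL hκ0 hκt hchart Ψ hΨ D hD hDχ hj hY hY0
  -- finiteness of the tube over `U`
  have hfin : ν (Ψ '' (M₀ ×ˢ U)) ≠ ∞ := by
    rw [hUeq, hM₀def, twistedTube_image_eq ι Λ ρ c pM pT Θ E ε T hΛ hα1 hρinj hc hΛ' hsum hidem hcT hTc ht₀ hT1 hTinv1 hE hε hΘ Ψ hΨ le_rfl
      (zero_mem _), measure_smul]
    refine ((measure_mono ?_).trans_lt ((hcomp0.image_of_continuousOn hcc).measure_lt_top (μ := ν))).ne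
    rintro _ ⟨_, ⟨Z, hZ, rfl⟩, rfl⟩
    exact ⟨Θ Z, hk0 (twisted_mem_level_slot ι Λ pM pT Θ E hΛ hα1 hΛ' hT1 hTinv1 hE hΘ Z hZ.1), rfl⟩
  -- the measurable embedding: continuity of `Ψ` (from `ε` continuous) and injectivity on `M₀ × U`
  haveI : PolishSpace G := Literature.Topology.Metrizable.polishSpace_of_locallyCompactSpace_of_secondCountableTopology G
  haveI : PolishSpace ↥T := hTcl.polishSpace
  have hΨc : Continuous Ψ := by
    have hΨeq : Ψ = fun p : G × ↥T => p.1 * (p.2 : G) * (ε p.1)⁻¹ := funext fun p => hΨ p.1 p.2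
    rw [hΨeq]
    exact (continuous_fst.mul (continuous_subtype_val.comp continuous_snd)).mul (hεc.comp continuous_fst).inv
  have hΨe : MeasurableEmbedding ((M₀ ×ˢ U).restrict Ψ) :=
    measurableEmbedding_restrict_of_continuousOn_injOn Ψ hM₀m hUo.measurableSet hΨc.continuousOn hinj
  exact measure_image_prod_eq_mul_lintegral_of_piSystem Ψ ν tm (quotientMeasure T tm hTcl ν ((QuotientGroup.mk : G → G ⧸ T) '' (c '' (Λ' k : Set V))))
    hUo hΨe hfin 𝒞 hπ hU𝒞 (fun C hC => (h𝒞o C hC).measurableSet) h𝒞U (fun O hO hOU => measurableSet_generateFrom_of_isOpen_of_basis 𝒞 h𝒞o hbasis hO hOU)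
    heq hV' hV'U

/-- **THE LOCAL ε-TWISTED TUBE-JACOBIAN SOCKET FROM CHART DATA** («W-LOC», `∃ U` form, explicit transversal `M₀ = c '' (pM '' Λ′ k)` and explicit transversal mass
`m₀ = quotientMeasure T tm _ ν (π c(Λ′_k))`): there is an open `U ∋ t₀` in `T` with `M₀` Borel, `0 < m₀ < ∞`, `Ψ` injective on `M₀ × U`, and
`ν(Ψ(M₀ × V′)) = m₀ · ∫⁻_{V′} D dtm` for every Borel `V′ ⊆ U` — `twistedTubeJacobianLocal_window` with `U = {b ∈ T | b ∈ t₀ c(Λ_k)}`; ε-twin of ★ C8b-socket-core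
`tubeJacobianLocal_of_chartData`. [cite: Rogawski1990, §12.5 p. 186] [cite: HarishChandra1970, Lemma 22] -/
theorem twistedTubeJacobianLocal_of_chartData (hTcl : IsClosed (T : Set G)) (hι : IsClosedEmbedding ι) (hΛ : ∀ j X, X ∈ Λ j ↔ ValBound (α ^ (j + 1)) (ι X))
    (hα : α ≠ 0) (hα1 : α < 1) (h2 : (2 : K) ≠ 0) (hρinj : Function.Injective ρ) (hc : ∀ X ∈ Λ 0, ((ρ (c X) : GL m K) : Matrix m m K) = cayley (ι X))
    (hcc : ContinuousOn c (Λ 0 : Set V)) (hK0 : IsOpen (c '' (Λ 0 : Set V)))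
    (hσ : ∀ W ∈ Λ 0, ∀ X ∈ Λ 0, ι (σV W X) = (1 - ι W)⁻¹ * (ι W + ι X) * (1 + ι W * ι X)⁻¹ * (1 - ι W))
    (hσc : ∀ W ∈ Λ 0, ContinuousOn (σV W) (Λ 0 : Set V))
    (hΛ' : ∀ j Z, Z ∈ Λ' j ↔ (pM Z ∈ Λ j ∧ pT Z ∈ Λ j)) (hsum : ∀ Z, pM Z + pT Z = Z) (hidem : ∀ Z, pM (pM Z) = pM Z)
    (hpMc : Continuous pM) (hpTc : Continuous pT) (hshift : ∀ j, ∀ Z ∈ Λ (j + k), pM Z ∈ Λ j ∧ pT Z ∈ Λ j)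
    (hΞ : ∀ Z ∈ Λ' k, ι (Ξ Z) = (1 - ι (pM Z))⁻¹ * (ι (pM Z) + ι (pT Z)) * (1 + ι (pM Z) * ι (pT Z))⁻¹ * (1 - ι (pM Z)))
    (hcT : ∀ Y ∈ Λ 0, pM Y = 0 → c Y ∈ T) (hTc : ∀ W ∈ Λ 0, c W ∈ T → pM W = 0) (ht₀ : t₀ ∈ T)
    (hT1 : ValBound 1 ((ρ t₀ : GL m K) : Matrix m m K)) (hTinv1 : ValBound 1 (((ρ t₀)⁻¹ : GL m K) : Matrix m m K))
    (hE : ∀ (γ : ValueGroupWithZero K) (W : Matrix m m K), ValBound γ W → ValBound γ (E W)) (hEc : Continuous E)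
    (hL : ∀ Z, ι (L Z) = (((ρ t₀)⁻¹ : GL m K) : Matrix m m K) * ι (pM Z) * ((ρ t₀ : GL m K) : Matrix m m K) + E (ι (pM Z)) + ι (pT Z))
    (hε : ∀ X ∈ Λ 0, (((ρ (ε (c X)))⁻¹ : GL m K) : Matrix m m K) = cayley (E (ι X))) (hεc : Continuous ε)
    (hΘ : ∀ Z ∈ Λ' k, ι (Θ Z) =
      (fun W X : Matrix m m K => (1 - W)⁻¹ * (W + X) * (1 + W * X)⁻¹ * (1 - W)) ((((ρ t₀)⁻¹ : GL m K) : Matrix m m K) * ι (pM Z) * ((ρ t₀ : GL m K) : Matrix m m K))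
        ((fun W X : Matrix m m K => (1 - W)⁻¹ * (W + X) * (1 + W * X)⁻¹ * (1 - W)) (ι (pT Z)) (E (ι (pM Z)))))
    (hshiftL : ∀ j, ∀ Z ∈ Λ (j + k), pM (L.symm Z) ∈ Λ j ∧ pT (L.symm Z) ∈ Λ j)
    {κ : ℝ≥0∞} (hκ0 : κ ≠ 0) (hκt : κ ≠ ∞) (hchart : ∀ B ⊆ (Λ 0 : Set V), MeasurableSet (c '' B) → κ * ν (c '' B) = μ B)
    (Ψ : G × ↥T → G) (hΨ : ∀ (x : G) (b : ↥T), Ψ (x, b) = x * b * (ε x)⁻¹)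
    (D : ↥T → ℝ≥0) (hD : ∀ b : ↥T, (b : G) ∈ t₀ • c '' (Λ k : Set V) → D b = D ⟨t₀, ht₀⟩) (hDχ : ((D ⟨t₀, ht₀⟩ : ℝ≥0) : ℝ≥0∞) = addEquivAddHaarChar L) :
    ∃ U : Set ↥T, IsOpen U ∧ (⟨t₀, ht₀⟩ : ↥T) ∈ U ∧
      MeasurableSet (c '' (pM '' (Λ' k : Set V))) ∧
      quotientMeasure T tm hTcl ν ((QuotientGroup.mk : G → G ⧸ T) '' (c '' (Λ' k : Set V))) ≠ 0 ∧
      quotientMeasure T tm hTcl ν ((QuotientGroup.mk : G → G ⧸ T) '' (c '' (Λ' k : Set V))) ≠ ∞ ∧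
      InjOn Ψ ((c '' (pM '' (Λ' k : Set V))) ×ˢ U) ∧
      ∀ V' : Set ↥T, MeasurableSet V' → V' ⊆ U →
        ν (Ψ '' ((c '' (pM '' (Λ' k : Set V))) ×ˢ V')) =
          quotientMeasure T tm hTcl ν ((QuotientGroup.mk : G → G ⧸ T) '' (c '' (Λ' k : Set V))) * ∫⁻ b in V', (D b : ℝ≥0∞) ∂tm := by
  obtain ⟨hUo, ht₀U, hM₀m, hne0, hnet, hinj, hid⟩ := twistedTubeJacobianLocal_window ι Λ ρ c σV pM pT L Θ Ξ E ε T μ ν tm hTcl hι hΛ hα hα1 h2 hρinj hc hcc hK0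
    hσ hσc hΛ' hsum hidem hpMc hpTc hshift hΞ hcT hTc ht₀ hT1 hTinv1 hE hEc hL hε hεc hΘ hshiftL hκ0 hκt hchart Ψ hΨ D hD hDχ
  exact ⟨_, hUo, ht₀U, hM₀m, hne0, hnet, hinj, hid⟩

/-- **W-LOC in the ORDER's literal shape** (K2E3-p03 (g10) 02:33:29Z (ii), S4-R44): `∃ U` open `∋ t₀`, `∃ M₀ = c '' (pM '' Λ′ k)` Borel, `∃ m₀ ≠ 0, ≠ ⊤` with
`ν(Ψ(M₀ × V′)) = m₀ · ∫⁻_{V′} D dtm` for every Borel `V′ ⊆ U` (here `m₀ = quotientMeasure T tm _ ν (π c(Λ′_k))`, see `twistedTubeJacobianLocal_of_chartData`).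
[cite: Rogawski1990, §12.5 p. 186] [cite: HarishChandra1970, Lemma 22] -/
theorem twistedTubeJacobianLocal_of_chartData' (hTcl : IsClosed (T : Set G)) (hι : IsClosedEmbedding ι) (hΛ : ∀ j X, X ∈ Λ j ↔ ValBound (α ^ (j + 1)) (ι X))
    (hα : α ≠ 0) (hα1 : α < 1) (h2 : (2 : K) ≠ 0) (hρinj : Function.Injective ρ) (hc : ∀ X ∈ Λ 0, ((ρ (c X) : GL m K) : Matrix m m K) = cayley (ι X))
    (hcc : ContinuousOn c (Λ 0 : Set V)) (hK0 : IsOpen (c '' (Λ 0 : Set V)))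
    (hσ : ∀ W ∈ Λ 0, ∀ X ∈ Λ 0, ι (σV W X) = (1 - ι W)⁻¹ * (ι W + ι X) * (1 + ι W * ι X)⁻¹ * (1 - ι W))
    (hσc : ∀ W ∈ Λ 0, ContinuousOn (σV W) (Λ 0 : Set V))
    (hΛ' : ∀ j Z, Z ∈ Λ' j ↔ (pM Z ∈ Λ j ∧ pT Z ∈ Λ j)) (hsum : ∀ Z, pM Z + pT Z = Z) (hidem : ∀ Z, pM (pM Z) = pM Z)
    (hpMc : Continuous pM) (hpTc : Continuous pT) (hshift : ∀ j, ∀ Z ∈ Λ (j + k), pM Z ∈ Λ j ∧ pT Z ∈ Λ j)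
    (hΞ : ∀ Z ∈ Λ' k, ι (Ξ Z) = (1 - ι (pM Z))⁻¹ * (ι (pM Z) + ι (pT Z)) * (1 + ι (pM Z) * ι (pT Z))⁻¹ * (1 - ι (pM Z)))
    (hcT : ∀ Y ∈ Λ 0, pM Y = 0 → c Y ∈ T) (hTc : ∀ W ∈ Λ 0, c W ∈ T → pM W = 0) (ht₀ : t₀ ∈ T)
    (hT1 : ValBound 1 ((ρ t₀ : GL m K) : Matrix m m K)) (hTinv1 : ValBound 1 (((ρ t₀)⁻¹ : GL m K) : Matrix m m K))
    (hE : ∀ (γ : ValueGroupWithZero K) (W : Matrix m m K), ValBound γ W → ValBound γ (E W)) (hEc : Continuous E)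
    (hL : ∀ Z, ι (L Z) = (((ρ t₀)⁻¹ : GL m K) : Matrix m m K) * ι (pM Z) * ((ρ t₀ : GL m K) : Matrix m m K) + E (ι (pM Z)) + ι (pT Z))
    (hε : ∀ X ∈ Λ 0, (((ρ (ε (c X)))⁻¹ : GL m K) : Matrix m m K) = cayley (E (ι X))) (hεc : Continuous ε)
    (hΘ : ∀ Z ∈ Λ' k, ι (Θ Z) =
      (fun W X : Matrix m m K => (1 - W)⁻¹ * (W + X) * (1 + W * X)⁻¹ * (1 - W)) ((((ρ t₀)⁻¹ : GL m K) : Matrix m m K) * ι (pM Z) * ((ρ t₀ : GL m K) : Matrix m m K))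
        ((fun W X : Matrix m m K => (1 - W)⁻¹ * (W + X) * (1 + W * X)⁻¹ * (1 - W)) (ι (pT Z)) (E (ι (pM Z)))))
    (hshiftL : ∀ j, ∀ Z ∈ Λ (j + k), pM (L.symm Z) ∈ Λ j ∧ pT (L.symm Z) ∈ Λ j)
    {κ : ℝ≥0∞} (hκ0 : κ ≠ 0) (hκt : κ ≠ ∞) (hchart : ∀ B ⊆ (Λ 0 : Set V), MeasurableSet (c '' B) → κ * ν (c '' B) = μ B)
    (Ψ : G × ↥T → G) (hΨ : ∀ (x : G) (b : ↥T), Ψ (x, b) = x * b * (ε x)⁻¹)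
    (D : ↥T → ℝ≥0) (hD : ∀ b : ↥T, (b : G) ∈ t₀ • c '' (Λ k : Set V) → D b = D ⟨t₀, ht₀⟩) (hDχ : ((D ⟨t₀, ht₀⟩ : ℝ≥0) : ℝ≥0∞) = addEquivAddHaarChar L) :
    ∃ U : Set ↥T, IsOpen U ∧ (⟨t₀, ht₀⟩ : ↥T) ∈ U ∧
      ∃ M₀ : Set G, M₀ = c '' (pM '' (Λ' k : Set V)) ∧ MeasurableSet M₀ ∧
        ∃ m₀ : ℝ≥0∞, m₀ ≠ 0 ∧ m₀ ≠ ∞ ∧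
          ∀ V' : Set ↥T, MeasurableSet V' → V' ⊆ U → ν (Ψ '' (M₀ ×ˢ V')) = m₀ * ∫⁻ b in V', (D b : ℝ≥0∞) ∂tm := by
  obtain ⟨U, hUo, ht₀U, hM₀m, hne0, hnet, -, hid⟩ := twistedTubeJacobianLocal_of_chartData ι Λ ρ c σV pM pT L Θ Ξ E ε T μ ν tm hTcl hι hΛ hα hα1 h2 hρinj
    hc hcc hK0 hσ hσc hΛ' hsum hidem hpMc hpTc hshift hΞ hcT hTc ht₀ hT1 hTinv1 hE hEc hL hε hεc hΘ hshiftL hκ0 hκt hchart Ψ hΨ D hD hDχ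
  exact ⟨U, hUo, ht₀U, _, rfl, hM₀m, _, hne0, hnet, hid⟩

end Measure

end Summit.HodgeConjecture.HodgeConjecture.R90.S4
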